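import Summits.QuantumAdvantage.QuantumAdvantage.Theorems.MobiusLadderLiouvilleOrthogonalTC0SpectralLevel
import Summits.QuantumAdvantage.QuantumAdvantage.Theorems.MobiusLadderLiouvilleOrthogonalTC0StubSpectralMoebius
import HarnessLib

/-!
# Crux `MobiusLadder.LiouvilleOrthogonalTC0` (stmt-QuantumAdvantage-1393), line `Sketch`, skeleton v12:
stub `stub_spectralLevel_moebius` — the spectral criterion at a single level, for `μ`

The Möbius twin (Kalai's formulation) of the landed single-level spectral criterion
`liouville_orthogonal_of_tailWeight_level` (`MobiusLadderLiouvilleOrthogonalTC0SpectralLevel.lean`):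
for every `R ≥ 30` and every `ε > 0`, eventually in `n`, EVERY Boolean function `F` of `n` bits
whose Fourier tail above the single level `⌊n^{1/R}⌋₊ + 1` is at most `(ε/3)²` satisfies
`|Σ_{N<2ⁿ} μ(N) sgn F(bits N)| ≤ ε 2ⁿ`; the threshold `n₀(ε, R)` does not depend on `F`.

Proof. The `λ` proof uses `λ` only through the uniform Walsh bound and `|λ| ≤ 1`, so we record the
weight-agnostic form (`StubSpectralLevelMoebius.orthogonal_of_tailWeight_level`): for any `1`-bounded
`g : ℕ → ℝ` with `|Σ_{N<2ⁿ} g(N) w_A(bits N)| ≤ 2^{n-n^c}` for all `A`, eventually in `n` (`c > 0`),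
and any `R ≥ 1` with `R c ≥ 3`, the conclusion holds with `g` in place of `μ` — Green 2012 §2
(`GreenAC0.core_bound`) with the empty and the small characters (`1 ≤ |S| ≤ k = ⌊n^{1/R}⌋₊`) bounded
by the Walsh bound and the arithmetic `LtfCore.low_term_le` (`(n+1)^k 2^{n-n^c} ≤ 2^{-k} 2ⁿ ≤ (ε/3) 2ⁿ`
once `k ≥ R + 1` and `2^{-k} ≤ ε/3`, which hold eventually since `k → ∞`), and the tail at level
`k + 1` by the hypothesis (`2ⁿ √((ε/3)²) = (ε/3) 2ⁿ`). Then instantiate with `g = μ` (`|μ| ≤ 1`,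
Mathlib's `ArithmeticFunction.abs_moebius_le_one`) and Bourgain's uniform Möbius–Walsh bound, PROVED in
the tree with exponent `c = 1/10` (`bourgain_moebius_walsh_holds`; non-strict form
`StubSpectralMoebius.eventually_walsh_bound`): `R ≥ 30` gives `R c ≥ 3`.
-/

set_option linter.dupNamespace false -- D-0017: single-problem summit ⇒ `QuantumAdvantage.QuantumAdvantage` by design

noncomputable section

namespace Summit.QuantumAdvantage.QuantumAdvantage.Theorems.LiouvilleOrthogonalTC0

open Filter Finset Topology
open Literature.Computability.Complexity
open Literature.Computability.Complexity.LowDegree (tailWeight)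
open Literature.Probability.RandomGraphs.LowDegree (sgn walsh walsh_empty)
open Literature.NumberTheory.Sieve

namespace StubSpectralLevelMoebius

/-- **The spectral criterion at a single level, for an arbitrary `1`-bounded weight.** Let
`g : ℕ → ℝ` with `|g(N)| ≤ 1`, let `c > 0`, and suppose the uniform Walsh bound
`|Σ_{N<2ⁿ} g(N) w_A(bits N)| ≤ 2^{n-n^c}` holds for all `A`, eventually in `n`; let `R ≥ 1` with
`3 ≤ R c`. Then for every `ε > 0`, for all sufficiently large `n`, every Boolean function `F` of `n`
bits with `W^{≥ ⌊n^{1/R}⌋₊+1}[sgn ∘ F] ≤ (ε/3)²` has `|Σ_{N<2ⁿ} g(N) · sgn F(bits N)| ≤ ε · 2ⁿ`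
(Green 2012 §2, `GreenAC0.core_bound`, with the small characters paid for by `LtfCore.low_term_le`). -/
theorem orthogonal_of_tailWeight_level (g : ℕ → ℝ) (hg : ∀ N, |g N| ≤ 1) {c : ℝ} (hc : 0 < c)
    (hB : ∀ᶠ n : ℕ in atTop, ∀ A : Finset (Fin n),
      |∑ N ∈ Finset.range (2 ^ n), g N * walsh A (fun j : Fin n => Nat.testBit N j)|
        ≤ (2 : ℝ) ^ ((n : ℝ) - (n : ℝ) ^ c))
    {R : ℕ} (hR1 : 1 ≤ R) (hRc : 3 ≤ (R : ℝ) * c) :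
    ∀ ε : ℝ, 0 < ε → ∀ᶠ n : ℕ in atTop, ∀ F : (Fin n → Bool) → Bool,
      tailWeight (fun x : Fin n → Bool => sgn (F x)) (⌊((n : ℝ)) ^ ((1 : ℝ) / R)⌋₊ + 1) ≤ (ε / 3) ^ 2 →
        |∑ N ∈ Finset.range (2 ^ n), g N * sgn (F (fun i : Fin n => Nat.testBit N i))|
          ≤ ε * (2 : ℝ) ^ n := by
  intro ε hε
  have hT := LtfCore.tendsto_floor_rpow hR1
  have hε3 : 0 < ε / 3 := by positivity
  have h1 : ∀ᶠ k : ℕ in atTop, R + 1 ≤ k := eventually_ge_atTop _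
  have h2 : ∀ᶠ k : ℕ in atTop, ((2 : ℝ)⁻¹) ^ k ≤ ε / 3 :=
    Filter.Tendsto.eventually_le_const hε3
      (tendsto_pow_atTop_nhds_zero_of_lt_one (by norm_num) (by norm_num))
  filter_upwards [hB, hT.eventually (h1.and h2)] with n hBn hpar F hF
  obtain ⟨hRk, hηk⟩ := hpar
  set k : ℕ := ⌊((n : ℝ)) ^ ((1 : ℝ) / R)⌋₊ with hkdef
  -- pass to the cube
  rw [MoebiusWalsh.sum_range_two_pow_eq_sum_cube
    (fun N => g N * sgn (F (fun i : Fin n => Nat.testBit N i)))]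
  simp only [MoebiusWalsh.ofFn_testBit_bitsToNat]
  set f : (Fin n → Bool) → ℝ := fun y => sgn (F y) with hfdef
  set G : (Fin n → Bool) → ℝ := fun y => g (bitsToNat (List.ofFn y)) with hGdef
  have hG : ∀ y, |G y| ≤ 1 := fun y => hg _
  have hf : ∀ y, |f y| ≤ 1 := fun y => by
    simp only [hfdef]; unfold sgn; split_ifs <;> simp
  -- the Walsh bound on the cube, for every character
  set B : ℝ := (2 : ℝ) ^ ((n : ℝ) - (n : ℝ) ^ c) with hBdef
  have hWalsh : ∀ A : Finset (Fin n), |∑ y, G y * walsh A y| ≤ B := by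
    intro A
    have h := hBn A
    rw [MoebiusWalsh.sum_range_two_pow_eq_sum_cube
      (fun N => g N * walsh A (fun j : Fin n => N.testBit j))] at h
    simp only [MoebiusWalsh.ofFn_testBit_bitsToNat] at h
    exact h
  have h0 : |∑ y, G y| ≤ B := by simpa using hWalsh ∅
  have hB0 : 0 ≤ B := by positivity
  have hcore := GreenAC0.core_bound (k := k) f G hf hG (E₀ := B) (E₁ := B)
    (τ := (ε / 3) ^ 2) hB0 h0 (fun S _ _ => hWalsh S) hF
  change |∑ y, G y * f y| ≤ ε * 2 ^ n
  refine hcore.trans ?_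
  -- the three cost terms
  have hkn : k ^ R ≤ n := LtfCore.floor_rpow_pow_le hR1 n
  have hnk : n < (k + 1) ^ R := LtfCore.lt_floor_rpow_succ_pow hR1 n
  have hlow : ((n : ℝ) + 1) ^ k * B ≤ ε / 3 * 2 ^ n := LtfCore.low_term_le hc hRc hkn hnk hRk hηk
  have hE0 : B ≤ ε / 3 * 2 ^ n := by
    refine le_trans ?_ hlow
    refine le_mul_of_one_le_left hB0 ?_
    exact one_le_pow₀ (by linarith [(Nat.cast_nonneg n : (0 : ℝ) ≤ n)])
  have hsqrt : Real.sqrt ((ε / 3) ^ 2) = ε / 3 := Real.sqrt_sq hε3.le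
  rw [hsqrt] at hcore ⊢
  have htail : (2 : ℝ) ^ n * (ε / 3) = ε / 3 * 2 ^ n := mul_comm _ _
  linarith

end StubSpectralLevelMoebius

/-- **Registered stub `stub_spectralLevel_moebius`** (line `Sketch`, skeleton v12): the spectral
criterion at a single level for `μ` (Kalai's formulation) — for `R ≥ 30` and `ε > 0`, eventually in
`n`, every Boolean function `F` of `n` bits with `W^{≥ ⌊n^{1/R}⌋₊+1}[sgn ∘ F] ≤ (ε/3)²` has
`|Σ_{N<2ⁿ} μ(N) sgn F(bits N)| ≤ ε 2ⁿ` (`StubSpectralLevelMoebius.orthogonal_of_tailWeight_level`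
with `g = μ`, `|μ| ≤ 1`, and Bourgain's proved uniform Möbius–Walsh bound with exponent `c = 1/10`,
`StubSpectralMoebius.eventually_walsh_bound`; `R ≥ 30` gives `R c ≥ 3`). -/
theorem stub_spectralLevel_moebius {R : ℕ} (hR : 30 ≤ R) :
    ∀ ε : ℝ, 0 < ε → ∀ᶠ n : ℕ in atTop, ∀ F : (Fin n → Bool) → Bool,
      tailWeight (fun x : Fin n → Bool => sgn (F x)) (⌊((n : ℝ)) ^ ((1 : ℝ) / R)⌋₊ + 1) ≤ (ε / 3) ^ 2 →
        |∑ N ∈ Finset.range (2 ^ n), ((ArithmeticFunction.moebius N : ℤ) : ℝ) *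
            sgn (F (fun i : Fin n => Nat.testBit N i))| ≤ ε * (2 : ℝ) ^ n := by
  -- `|μ| ≤ 1` (Mathlib's `ArithmeticFunction.abs_moebius_le_one`, an `ℤ` statement)
  have hg : ∀ N : ℕ, |((ArithmeticFunction.moebius N : ℤ) : ℝ)| ≤ 1 := fun N => by
    exact_mod_cast ArithmeticFunction.abs_moebius_le_one
  -- Bourgain's exponent for `μ` and the parameter constraints `1 ≤ R`, `3 ≤ R / 10`
  have hc : (0 : ℝ) < (1 : ℝ) / 10 := by norm_num
  have hR1 : 1 ≤ R := le_trans (by norm_num) hR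
  have hRc : (3 : ℝ) ≤ (R : ℝ) * ((1 : ℝ) / 10) := by
    have h30 : (30 : ℝ) ≤ R := by exact_mod_cast hR
    linarith
  exact StubSpectralLevelMoebius.orthogonal_of_tailWeight_level
    (fun N => ((ArithmeticFunction.moebius N : ℤ) : ℝ)) hg hc
    StubSpectralMoebius.eventually_walsh_bound hR1 hRc

end Summit.QuantumAdvantage.QuantumAdvantage.Theorems.LiouvilleOrthogonalTC0
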